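/-
Copyright (c) 2026 the pub-hodgecm-mathlib formalisation cell (harness21).  Prover seat hodgecm-mathlib-K2E3-p23 (g3), Track B «K2-LIT» ∕ h413
(`stmt-HodgeConjecture-24833`), line `K2_E3_EllipticInputs`, 13a road A (line lead K2E3-p10 (g3)), item (D3) «Witt–Cartan, K₀-group currency, normalised
kernel», file G1.  2026-09-04.
-/
import Summits.HodgeConjecture.HodgeConjecture.Theorems.K2E3WittIwasawa      -- ★ F1–F3 (this seat): `h_W` tools, `exists_v_eq_one_hyperbolic`, `apply_eq_sum_inv_of_hyperbolic`, `hermForm_inv_mulVec_left`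
import HarnessLib

/-!
# Crux `H413` — K2-LIT E3 «EllipticInputs», 13a road A, item (D3) G1: THE PIVOT of the Cartan decomposition of `U(σ, W)`, `W = wittFormOn e Han` with a
# NORMALISED anisotropic kernel — a maximal entry of `q` or `q⁻¹` inside a `rev`-stable frame can be taken at a HYPERBOLIC row and a HYPERBOLIC column

Cell `hodgecm-mathlib`, Track B «K2-LIT», crux item `stmt-HodgeConjecture-24833` (h413), socket U12-g ‹13a› road A.  Item (D3) of the lead's RULINGS #13 (K2 bus
2026-09-04T02:16:29Z): the Cartan decomposition `U(σ, W)(K) = K₀ · T · K₀`, `K₀ = U ∩ GL_N(𝒪)`, `T = {diag(d) : σ(d_a) d_{rev a} = 1, d ≡ 1 on the kernel}`, for a Witt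
form with NORMALISED anisotropic kernel of any size `m` (letter `hrawW`).  The proof is a FRAME INDUCTION inside `U(σ, W)` (G3) whose step is p09's maximal-pivot
elimination (★ p856681, `J₀`) rewritten with the kernel (G2); this file supplies the PIVOT: with a kernel the maximal entry may sit in a kernel column, where the
column is NOT isotropic — but its norm `|Han_bb| · M⁻² ≤ |ϖ|²` is small, so the «unit hyperbolic coordinate» lemma still applies (§2), and the row identity
`q_{sb} = Σ_{p ∈ kernel} σ((q⁻¹)_{p, rev s}) Han_{pb}` (★ F3 `apply_eq_sum_inv_of_hyperbolic`) moves the maximum to a HYPERBOLIC column of `q⁻¹` (§3).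

SETTING as in ★ F1–F3: `K` with `Valued K ℤᵐ⁰`, `σ` an involution preserving `v`, a uniformiser `ϖ`, `e : WittIndex r m ≃ Fin N` standard (`hstd`), `Han` hermitian
(`hHan`), integral (`hint`), normalised (`hmax`); hyperbolic position `a.val < r ∨ r + m ≤ a.val`; `U = ↥(unitaryGroupOfForm σ W)`.

* §1 tools: `hermForm_inv_mulVec_right` (`h(u, g⁻¹ v) = h(g u, v)`), **`inv_apply_of_hyperbolic`** (`(g⁻¹)_{ab} = σ(g_{rev b, rev a})` for hyperbolic `a, b`),
  `eigen_ne_zero` ∕ `inv_mulVec_single_of_eigen` (`q e_a = c e_a ⇒ c ≠ 0`, `q⁻¹ e_a = c⁻¹ e_a`), **`mulVec_mem_frame_of_eigen`** (if `q` has the `e_a`, `a ∉ S`, as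
  eigenvectors — `S` `rev`-stable with hyperbolic complement — then `q` preserves `K^S`).
* §2 **`exists_v_eq_one_hyperbolic_of_v_le`** — ★ F1's lemma with `h_W(x,x) = 0` weakened to `|h_W(x,x)| ≤ |ϖ|²`.
* §3 **`exists_hyperbolic_row_of_hyperbolic_col`**, **`exists_hyperbolic_row_of_kernel_col`**, **`exists_hyperbolic_pivot`** — if the entries of `g` and `g⁻¹` on
  `S × S` are bounded by `M > 1` and `g` attains `M` on `S × S`, then `g` or `g⁻¹` attains `M` at a position `(s, t) ∈ S × S` with `s` AND `t` hyperbolic.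

`--supports stmt-HodgeConjecture-24833 --as helper`.  THEOREMS ONLY — no `def`, no named fact, no instance, no notation, no `sorry`.  HONEST LABEL: HC_CM is
proved only modulo the 7 printed citations (2 remaining named inputs: hLiu418 = stmt-HodgeConjecture-24832, h413 = stmt-HodgeConjecture-24833) until rung 0
closes; unconditional local algebra, closes no organ by itself.

References: [BruhatTits1972] F. Bruhat, J. Tits, Publ. Math. IHÉS 41 (1972), (4.4.3) · [Tits1979] J. Tits, PSPM 33.1 (1979), §3.3.3 · [Macdonald1995] I. G.
Macdonald, *Symmetric Functions and Hall Polynomials* (1995), Ch. V §2 (maximal pivot) · [Jacobowitz1962] R. Jacobowitz, Amer. J. Math. 84 (1962), §§4, 7 ·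
[Omeara1963] O. T. O'Meara, *Introduction to Quadratic Forms* (1963), §82F, §91A.
-/

set_option autoImplicit false
-- the mandated namespace repeats `HodgeConjecture.HodgeConjecture`, as in every `Theorems/*.lean` of this sub-problem
set_option linter.dupNamespace false

noncomputable section

open scoped Matrix MatrixGroups Valued WithZero
open Matrix

namespace Summit.HodgeConjecture.HodgeConjecture.Cruxes.H413.K2E3WittCartanPivot

open Literature.NumberTheory.Automorphic Literature.NumberTheory.Automorphic.UnitaryGroup Literature.NumberTheory.Automorphic.HermitianLattice
open K2E3LocalUnitaryWitt K2E3WittCartanUnramified K2E3WittParabolicBlocks K2E3WittHermFormStd K2E3WittIntegralMoves K2E3WittIntegralTransitive K2E3WittIwasawa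

/-! ## §1 Tools: inverse entries at hyperbolic positions, eigenvectors, frame stability -/

section Tools

variable {K : Type*} [Field K] (σ : K →+* K) {N r m : ℕ} (e : WittIndex r m ≃ Fin N)
  (hstd : ∀ x, (e x).val = Sum.elim (fun i : Fin r => i.val) (Sum.elim (fun u : Fin m => r + u.val) (fun j : Fin r => r + m + j.val)) x)
  (Han : Matrix (Fin m) (Fin m) K)

/-- **`h(u, g⁻¹ v) = h(g u, v)`** for `g ∈ U(σ, H)`. [cite: Dieudonne1971GroupesClassiques, Chap. II §5] -/
theorem hermForm_inv_mulVec_right {H : Matrix (Fin N) (Fin N) K} (g : unitaryGroupOfForm σ H) (u v : Fin N → K) :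
    hermForm σ H u ((((g : GL (Fin N) K)⁻¹ : GL (Fin N) K) : Matrix (Fin N) (Fin N) K) *ᵥ v) =
      hermForm σ H (((g : GL (Fin N) K) : Matrix (Fin N) (Fin N) K) *ᵥ u) v := by
  conv_rhs => rw [← mulVec_inv_mulVec g v]
  rw [hermForm_mulVec_mulVec]

include hstd in
/-- **`(g⁻¹)_{ab} = σ(g_{rev b, rev a})` at hyperbolic positions `a, b`** (`(g⁻¹)_{ab} = h_W(e_{rev a}, g⁻¹ e_b) = h_W(g e_{rev a}, e_b)`).
[cite: Rogawski1990, §1.9] [cite: BruhatTits1972, (4.4.3)] -/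
theorem inv_apply_of_hyperbolic (g : unitaryGroupOfForm σ (wittFormOn e Han)) {a b : Fin N} (ha : a.val < r ∨ r + m ≤ a.val) (hb : b.val < r ∨ r + m ≤ b.val) :
    (((g : GL (Fin N) K)⁻¹ : GL (Fin N) K) : Matrix (Fin N) (Fin N) K) a b = σ (((g : GL (Fin N) K) : Matrix (Fin N) (Fin N) K) (Fin.rev b) (Fin.rev a)) := by
  have h1 : (((g : GL (Fin N) K)⁻¹ : GL (Fin N) K) : Matrix (Fin N) (Fin N) K) a b =
      hermForm σ (wittFormOn e Han) (Pi.single (Fin.rev a) 1) ((((g : GL (Fin N) K)⁻¹ : GL (Fin N) K) : Matrix (Fin N) (Fin N) K) *ᵥ Pi.single b 1) := by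
    rw [hermForm_witt_single_left σ e hstd Han (rev_hyperbolic e ha), Fin.rev_rev, ← apply_eq_mulVec_single]
  rw [h1, hermForm_inv_mulVec_right, hermForm_witt_single_right σ e hstd Han hb, ← apply_eq_mulVec_single]

/-- An «eigenvalue» of an invertible matrix on a basis vector is non-zero. [folklore] -/
theorem eigen_ne_zero {H : Matrix (Fin N) (Fin N) K} (q : unitaryGroupOfForm σ H) {a : Fin N} {c : K}
    (h : ((q : GL (Fin N) K) : Matrix (Fin N) (Fin N) K) *ᵥ Pi.single a 1 = c • Pi.single a 1) : c ≠ 0 := by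
  intro hc
  rw [hc, zero_smul] at h
  have h1 := congrArg (fun w => (((q : GL (Fin N) K)⁻¹ : GL (Fin N) K) : Matrix (Fin N) (Fin N) K) *ᵥ w) h
  simp only [inv_mulVec_mulVec, Matrix.mulVec_zero] at h1
  have h2 := congrFun h1 a
  rw [Pi.single_eq_same, Pi.zero_apply] at h2
  exact one_ne_zero h2

/-- `q e_a = c e_a ⇒ q⁻¹ e_a = c⁻¹ e_a`. [folklore] -/
theorem inv_mulVec_single_of_eigen {H : Matrix (Fin N) (Fin N) K} (q : unitaryGroupOfForm σ H) {a : Fin N} {c : K}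
    (h : ((q : GL (Fin N) K) : Matrix (Fin N) (Fin N) K) *ᵥ Pi.single a 1 = c • Pi.single a 1) :
    (((q : GL (Fin N) K)⁻¹ : GL (Fin N) K) : Matrix (Fin N) (Fin N) K) *ᵥ Pi.single a 1 = c⁻¹ • Pi.single a 1 := by
  have hc := eigen_ne_zero σ q h
  have h1 := congrArg (fun w => (((q : GL (Fin N) K)⁻¹ : GL (Fin N) K) : Matrix (Fin N) (Fin N) K) *ᵥ w) h
  simp only [inv_mulVec_mulVec, Matrix.mulVec_smul] at h1
  rw [← smul_right_injective (Fin N → K) hc |>.eq_iff]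
  simp only [smul_smul, mul_inv_cancel₀ hc, one_smul]
  exact h1.symm

include hstd in
/-- **Frame stability from eigenvectors.**  Let `S ⊆ Fin N` be `rev`-stable with hyperbolic complement, and let `q ∈ U(σ, W)` have every `e_a`, `a ∉ S`, as an eigenvector.
Then `q` maps `K^S` into `K^S`: `(q v)_a = h_W(e_{rev a}, q v) = h_W(q⁻¹ e_{rev a}, v) = σ(c⁻¹) v_a = 0`. [cite: BruhatTits1972, (4.4.3)] [cite: Tits1979, §3.3.2] -/
theorem mulVec_mem_frame_of_eigen (q : unitaryGroupOfForm σ (wittFormOn e Han)) {S : Finset (Fin N)} (hS : ∀ i ∈ S, Fin.rev i ∈ S)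
    (hSc : ∀ a : Fin N, a ∉ S → (a.val < r ∨ r + m ≤ a.val))
    (heig : ∀ a : Fin N, a ∉ S → ∃ c : K, ((q : GL (Fin N) K) : Matrix (Fin N) (Fin N) K) *ᵥ Pi.single a 1 = c • Pi.single a 1)
    {v : Fin N → K} (hv : v ∈ frame K N S) : ((q : GL (Fin N) K) : Matrix (Fin N) (Fin N) K) *ᵥ v ∈ frame K N S := by
  intro a ha
  have hra : Fin.rev a ∉ S := fun h => ha (by rw [← Fin.rev_rev a]; exact hS _ h)
  obtain ⟨c, hc⟩ := heig (Fin.rev a) hra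
  have h1 : (((q : GL (Fin N) K) : Matrix (Fin N) (Fin N) K) *ᵥ v) a =
      hermForm σ (wittFormOn e Han) (Pi.single (Fin.rev a) 1) (((q : GL (Fin N) K) : Matrix (Fin N) (Fin N) K) *ᵥ v) := by
    rw [hermForm_witt_single_left σ e hstd Han (hSc _ hra), Fin.rev_rev]
  rw [h1, ← hermForm_inv_mulVec_left, inv_mulVec_single_of_eigen σ q hc, hermForm_smul_left_eq, hermForm_witt_single_left σ e hstd Han (hSc _ hra),
    Fin.rev_rev, hv a ha, mul_zero]

end Tools

/-! ## §2 A primitive vector of small norm has a unit hyperbolic coordinate -/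

section SmallNorm

variable {K : Type*} [Field K] [Valued K ℤᵐ⁰] (σ : K →+* K) {N r m : ℕ} (e : WittIndex r m ≃ Fin N)
  (hstd : ∀ x, (e x).val = Sum.elim (fun i : Fin r => i.val) (Sum.elim (fun u : Fin m => r + u.val) (fun j : Fin r => r + m + j.val)) x)
  (Han : Matrix (Fin m) (Fin m) K)

include hstd in
/-- **A primitive vector of `𝒪^N` with `|h_W(x,x)| ≤ |ϖ|²` has a unit coordinate at a HYPERBOLIC position** (normalised kernel) — ★ F1 `exists_v_eq_one_hyperbolic` with
isotropy weakened to small norm: if all hyperbolic coordinates lie in `𝔭` then `|h_an(x_mid, x_mid)| ≤ max(|h_W(x,x)|, |hyperbolic part|) ≤ |ϖ|²`, so `ϖ⁻¹ x_mid ∈ 𝒪^m` and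
`x ∈ ϖ𝒪^N`. [cite: Omeara1963, §82F, §91A] [cite: Jacobowitz1962, §4] -/
theorem exists_v_eq_one_hyperbolic_of_v_le (hvσ : ∀ a, Valued.v (σ a) = Valued.v a) {ϖ : K} (hϖ : Valued.v ϖ = WithZero.exp (-1 : ℤ))
    (hmax : ∀ z : Fin m → K, Valued.v (hermForm σ Han z z) ≤ 1 → z ∈ stdLattice K m)
    {x : Fin N → K} (hx : x ∈ stdLattice K N) (hunit : ∃ j, Valued.v (x j) = 1)
    (hsmall : Valued.v (hermForm σ (wittFormOn e Han) x x) ≤ Valued.v ϖ * Valued.v ϖ) :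
    ∃ a : Fin N, (a.val < r ∨ r + m ≤ a.val) ∧ Valued.v (x a) = 1 := by
  by_contra H
  push Not at H
  have hϖ0 : ϖ ≠ 0 := fun h0 => by rw [h0, map_zero] at hϖ; exact WithZero.coe_ne_zero hϖ.symm
  have hlt : ∀ a : Fin N, (a.val < r ∨ r + m ≤ a.val) → Valued.v (x a) ≤ Valued.v ϖ := fun a ha => by
    rw [hϖ]; exact (v_lt_one_iff _).1 (lt_of_le_of_ne (hx a) (H a ha))
  have hhyp : Valued.v (∑ i : Fin r, (σ (x (e (Sum.inl i))) * x (Fin.rev (e (Sum.inl i))) +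
      σ (x (e (Sum.inr (Sum.inr i)))) * x (Fin.rev (e (Sum.inr (Sum.inr i)))))) ≤ Valued.v ϖ * Valued.v ϖ := by
    refine Valuation.map_sum_le _ fun i _ => (Valuation.map_add _ _ _).trans (max_le ?_ ?_)
    · rw [map_mul, hvσ]
      exact mul_le_mul' (hlt _ (apply_inl_hyperbolic e hstd i)) (hlt _ (rev_hyperbolic e (apply_inl_hyperbolic e hstd i)))
    · rw [map_mul, hvσ]
      exact mul_le_mul' (hlt _ (apply_inr_inr_hyperbolic e hstd i)) (hlt _ (rev_hyperbolic e (apply_inr_inr_hyperbolic e hstd i)))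
  have hsplit := hermForm_witt_eq_sum_add σ e hstd Han x x
  have han : Valued.v (hermForm σ Han (fun u => x (e (Sum.inr (Sum.inl u)))) (fun u => x (e (Sum.inr (Sum.inl u))))) ≤ Valued.v ϖ * Valued.v ϖ := by
    have h := eq_sub_of_add_eq' hsplit.symm
    rw [h]
    exact (Valuation.map_sub _ _ _).trans (max_le hsmall hhyp)
  have hv0 : Valued.v ϖ ≠ 0 := (Valuation.ne_zero_iff _).2 hϖ0
  have hmid : (ϖ⁻¹ • fun u => x (e (Sum.inr (Sum.inl u)))) ∈ stdLattice K m := by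
    refine hmax _ ?_
    rw [hermForm_smul_left_eq, hermForm_smul_right, map_mul, map_mul, hvσ, map_inv₀]
    calc (Valued.v ϖ)⁻¹ * ((Valued.v ϖ)⁻¹ * Valued.v (hermForm σ Han (fun u => x (e (Sum.inr (Sum.inl u)))) fun u => x (e (Sum.inr (Sum.inl u)))))
        ≤ (Valued.v ϖ)⁻¹ * ((Valued.v ϖ)⁻¹ * (Valued.v ϖ * Valued.v ϖ)) := mul_le_mul' le_rfl (mul_le_mul' le_rfl han)
      _ = 1 := by rw [inv_mul_cancel_left₀ hv0, inv_mul_cancel₀ hv0]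
  obtain ⟨j, hj⟩ := hunit
  have hj' : Valued.v (x j) < 1 := by
    by_cases hjh : j.val < r ∨ r + m ≤ j.val
    · exact lt_of_le_of_ne (hx j) (H j hjh)
    · have h₁ : r ≤ j.val := by omega
      have h₂ : j.val < r + m := by omega
      have hmem := hmid ⟨j.val - r, by omega⟩
      rw [Pi.smul_apply, smul_eq_mul, map_mul, map_inv₀, ← eq_apply_inr_inl_of e hstd h₁ h₂] at hmem
      have h3 : Valued.v (x j) ≤ Valued.v ϖ := by
        have := mul_le_mul' (le_refl (Valued.v ϖ)) hmem
        rwa [← mul_assoc, mul_inv_cancel₀ hv0, one_mul, mul_one] at this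
      exact lt_of_le_of_lt h3 (by rw [hϖ, ← WithZero.exp_zero, WithZero.exp_lt_exp]; norm_num)
  rw [hj] at hj'
  exact lt_irrefl _ hj'

end SmallNorm

/-! ## §3 The pivot: a maximal entry at a hyperbolic row and a hyperbolic column, for `q` or `q⁻¹` -/

section Pivot

variable {K : Type*} [Field K] [Valued K ℤᵐ⁰] (σ : K →+* K) {N r m : ℕ} (e : WittIndex r m ≃ Fin N)
  (hstd : ∀ x, (e x).val = Sum.elim (fun i : Fin r => i.val) (Sum.elim (fun u : Fin m => r + u.val) (fun j : Fin r => r + m + j.val)) x)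
  (Han : Matrix (Fin m) (Fin m) K)

include hstd in
/-- **A HYPERBOLIC column attaining the bound has a HYPERBOLIC row attaining it.**  Let the column `y = g e_t` (`t` hyperbolic, so `y` is isotropic) lie in `K^S`
with entries bounded by `M` and `|y_{a₀}| = M ≠ 0`.  Then `|y_s| = M` at some hyperbolic `s ∈ S` (★ F1 on the primitive isotropic `y_{a₀}⁻¹ y`).
[cite: Macdonald1995, Ch. V §2] [cite: BruhatTits1972, (4.4.3)] -/
theorem exists_hyperbolic_row_of_hyperbolic_col (hvσ : ∀ a, Valued.v (σ a) = Valued.v a) {ϖ : K} (hϖ : Valued.v ϖ = WithZero.exp (-1 : ℤ))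
    (hmax : ∀ z : Fin m → K, Valued.v (hermForm σ Han z z) ≤ 1 → z ∈ stdLattice K m)
    (g : unitaryGroupOfForm σ (wittFormOn e Han)) {S : Finset (Fin N)} {t : Fin N} (ht : t.val < r ∨ r + m ≤ t.val)
    (hyS : ((g : GL (Fin N) K) : Matrix (Fin N) (Fin N) K) *ᵥ Pi.single t 1 ∈ frame K N S) {M : ℤᵐ⁰}
    (hle : ∀ a, Valued.v (((g : GL (Fin N) K) : Matrix (Fin N) (Fin N) K) a t) ≤ M) {a₀ : Fin N}
    (ha₀ : Valued.v (((g : GL (Fin N) K) : Matrix (Fin N) (Fin N) K) a₀ t) = M) (hM0 : M ≠ 0) :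
    ∃ s ∈ S, (s.val < r ∨ r + m ≤ s.val) ∧ Valued.v (((g : GL (Fin N) K) : Matrix (Fin N) (Fin N) K) s t) = M := by
  set lam : K := ((g : GL (Fin N) K) : Matrix (Fin N) (Fin N) K) a₀ t with hlam
  have hlam0 : lam ≠ 0 := fun h => hM0 (by rw [← ha₀, h, map_zero])
  set x : Fin N → K := lam⁻¹ • (((g : GL (Fin N) K) : Matrix (Fin N) (Fin N) K) *ᵥ Pi.single t 1) with hx
  have hxa : ∀ a, x a = lam⁻¹ * ((g : GL (Fin N) K) : Matrix (Fin N) (Fin N) K) a t := fun a => by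
    rw [hx, Pi.smul_apply, smul_eq_mul, ← apply_eq_mulVec_single]
  have hxL : x ∈ stdLattice K N := fun a => by
    rw [hxa, map_mul, map_inv₀, ha₀]
    calc M⁻¹ * Valued.v (((g : GL (Fin N) K) : Matrix (Fin N) (Fin N) K) a t) ≤ M⁻¹ * M := mul_le_mul' le_rfl (hle a)
      _ = 1 := inv_mul_cancel₀ hM0
  have hx1 : Valued.v (x a₀) = 1 := by rw [hxa, ← hlam, inv_mul_cancel₀ hlam0, map_one]
  have hxiso : hermForm σ (wittFormOn e Han) x x = 0 := by
    rw [hx]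
    refine hermForm_smul_smul_self_eq_zero σ _ ?_ _
    rw [hermForm_mulVec_mulVec]
    exact hermForm_witt_single_single_of_hyperbolic σ e hstd Han ht
  obtain ⟨s, hs, hsv⟩ := exists_v_eq_one_hyperbolic σ e hstd Han hvσ hϖ hmax hxL ⟨a₀, hx1⟩ hxiso
  have hsS : s ∈ S := by
    by_contra h
    have : x s = 0 := by rw [hx]; exact (Submodule.smul_mem _ _ hyS : x ∈ frame K N S) s h
    rw [this, map_zero] at hsv
    exact zero_ne_one hsv
  refine ⟨s, hsS, hs, ?_⟩
  have h := hsv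
  rw [hxa, map_mul, map_inv₀, ha₀] at h
  calc Valued.v (((g : GL (Fin N) K) : Matrix (Fin N) (Fin N) K) s t) = M * (M⁻¹ * Valued.v (((g : GL (Fin N) K) : Matrix (Fin N) (Fin N) K) s t)) := by
        rw [← mul_assoc, mul_inv_cancel₀ hM0, one_mul]
    _ = M := by rw [h, mul_one]

include hstd in
/-- **A KERNEL column attaining the bound `M > 1` has a HYPERBOLIC row attaining it** (normalised kernel): the column `y = g e_b` has `h_W(y,y) = W_{bb} = Han`-entry,
so the primitive `x = y_{a₀}⁻¹ y` has `|h_W(x,x)| ≤ M⁻² ≤ |ϖ|²` and §2 applies. [cite: Macdonald1995, Ch. V §2] [cite: Jacobowitz1962, §7] -/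
theorem exists_hyperbolic_row_of_kernel_col (hvσ : ∀ a, Valued.v (σ a) = Valued.v a) {ϖ : K} (hϖ : Valued.v ϖ = WithZero.exp (-1 : ℤ))
    (hint : ∀ u u', Valued.v (Han u u') ≤ 1) (hmax : ∀ z : Fin m → K, Valued.v (hermForm σ Han z z) ≤ 1 → z ∈ stdLattice K m)
    (g : unitaryGroupOfForm σ (wittFormOn e Han)) {S : Finset (Fin N)} {b : Fin N}
    (hyS : ((g : GL (Fin N) K) : Matrix (Fin N) (Fin N) K) *ᵥ Pi.single b 1 ∈ frame K N S) {M : ℤᵐ⁰} (hM1 : 1 < M)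
    (hle : ∀ a, Valued.v (((g : GL (Fin N) K) : Matrix (Fin N) (Fin N) K) a b) ≤ M) {a₀ : Fin N}
    (ha₀ : Valued.v (((g : GL (Fin N) K) : Matrix (Fin N) (Fin N) K) a₀ b) = M) :
    ∃ s ∈ S, (s.val < r ∨ r + m ≤ s.val) ∧ Valued.v (((g : GL (Fin N) K) : Matrix (Fin N) (Fin N) K) s b) = M := by
  have hM0 : M ≠ 0 := ne_of_gt (lt_trans zero_lt_one hM1)
  set lam : K := ((g : GL (Fin N) K) : Matrix (Fin N) (Fin N) K) a₀ b with hlam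
  have hlam0 : lam ≠ 0 := fun h => hM0 (by rw [← ha₀, h, map_zero])
  set x : Fin N → K := lam⁻¹ • (((g : GL (Fin N) K) : Matrix (Fin N) (Fin N) K) *ᵥ Pi.single b 1) with hx
  have hxa : ∀ a, x a = lam⁻¹ * ((g : GL (Fin N) K) : Matrix (Fin N) (Fin N) K) a b := fun a => by
    rw [hx, Pi.smul_apply, smul_eq_mul, ← apply_eq_mulVec_single]
  have hxL : x ∈ stdLattice K N := fun a => by
    rw [hxa, map_mul, map_inv₀, ha₀]
    calc M⁻¹ * Valued.v (((g : GL (Fin N) K) : Matrix (Fin N) (Fin N) K) a b) ≤ M⁻¹ * M := mul_le_mul' le_rfl (hle a)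
      _ = 1 := inv_mul_cancel₀ hM0
  have hx1 : Valued.v (x a₀) = 1 := by rw [hxa, ← hlam, inv_mul_cancel₀ hlam0, map_one]
  -- `|λ⁻¹| ≤ |ϖ|`
  have hlaminv : Valued.v lam⁻¹ ≤ Valued.v ϖ := by
    rw [hϖ]
    refine (v_lt_one_iff _).1 ?_
    rw [map_inv₀, ha₀]
    exact inv_lt_one_of_one_lt₀ hM1
  have hsmall : Valued.v (hermForm σ (wittFormOn e Han) x x) ≤ Valued.v ϖ * Valued.v ϖ := by
    rw [hx, hermForm_smul_left_eq, hermForm_smul_right, hermForm_mulVec_mulVec, hermForm_single_single, map_mul, map_mul, hvσ]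
    calc Valued.v lam⁻¹ * (Valued.v lam⁻¹ * Valued.v (wittFormOn e Han b b)) ≤ Valued.v ϖ * (Valued.v ϖ * 1) :=
          mul_le_mul' hlaminv (mul_le_mul' hlaminv (v_wittFormOn_apply_le_one e Han hint b b))
      _ = Valued.v ϖ * Valued.v ϖ := by rw [mul_one]
  obtain ⟨s, hs, hsv⟩ := exists_v_eq_one_hyperbolic_of_v_le σ e hstd Han hvσ hϖ hmax hxL ⟨a₀, hx1⟩ hsmall
  have hsS : s ∈ S := by
    by_contra h
    have : x s = 0 := by rw [hx]; exact (Submodule.smul_mem _ _ hyS : x ∈ frame K N S) s h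
    rw [this, map_zero] at hsv
    exact zero_ne_one hsv
  refine ⟨s, hsS, hs, ?_⟩
  have h := hsv
  rw [hxa, map_mul, map_inv₀, ha₀] at h
  calc Valued.v (((g : GL (Fin N) K) : Matrix (Fin N) (Fin N) K) s b) = M * (M⁻¹ * Valued.v (((g : GL (Fin N) K) : Matrix (Fin N) (Fin N) K) s b)) := by
        rw [← mul_assoc, mul_inv_cancel₀ hM0, one_mul]
    _ = M := by rw [h, mul_one]

include hstd in
/-- **THE PIVOT.**  Let `S ⊆ Fin N` contain the kernel positions, let the columns `g e_b`, `g⁻¹ e_b` (`b ∈ S`) lie in `K^S`, and let the entries of `g` and of `g⁻¹` on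
`S × S` be bounded by `M > 1`, with `g` attaining `M` on `S × S`.  Then `g` OR `g⁻¹` attains `M` at some `(s, t) ∈ S × S` with `s` and `t` HYPERBOLIC: for a hyperbolic
column use `exists_hyperbolic_row_of_hyperbolic_col`; for a kernel column `b`, `exists_hyperbolic_row_of_kernel_col` gives a hyperbolic row `s`, and the row identity
`g_{sb} = Σ_{p ∈ kernel} σ((g⁻¹)_{p, rev s}) Han_{pb}` (★ F3 `apply_eq_sum_inv_of_hyperbolic`; `Han` integral) forces `|(g⁻¹)_{p, rev s}| = M` for some kernel `p`, i.e.
`g⁻¹` attains `M` in the HYPERBOLIC column `rev s ∈ S`, where the first lemma applies to `g⁻¹`. [cite: Macdonald1995, Ch. V §2] [cite: BruhatTits1972, (4.4.3)]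
[cite: Jacobowitz1962, §7] -/
theorem exists_hyperbolic_pivot (hvσ : ∀ a, Valued.v (σ a) = Valued.v a) {ϖ : K} (hϖ : Valued.v ϖ = WithZero.exp (-1 : ℤ))
    (hint : ∀ u u', Valued.v (Han u u') ≤ 1) (hmax : ∀ z : Fin m → K, Valued.v (hermForm σ Han z z) ≤ 1 → z ∈ stdLattice K m)
    (g : unitaryGroupOfForm σ (wittFormOn e Han)) {S : Finset (Fin N)} (hS : ∀ i ∈ S, Fin.rev i ∈ S) (hSk : ∀ a : Fin N, r ≤ a.val → a.val < r + m → a ∈ S)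
    (hgS : ∀ b ∈ S, ((g : GL (Fin N) K) : Matrix (Fin N) (Fin N) K) *ᵥ Pi.single b 1 ∈ frame K N S)
    (hgiS : ∀ b ∈ S, (((g : GL (Fin N) K)⁻¹ : GL (Fin N) K) : Matrix (Fin N) (Fin N) K) *ᵥ Pi.single b 1 ∈ frame K N S)
    {M : ℤᵐ⁰} (hM1 : 1 < M)
    (hle : ∀ a ∈ S, ∀ b ∈ S, Valued.v (((g : GL (Fin N) K) : Matrix (Fin N) (Fin N) K) a b) ≤ M)
    (hlei : ∀ a ∈ S, ∀ b ∈ S, Valued.v ((((g : GL (Fin N) K)⁻¹ : GL (Fin N) K) : Matrix (Fin N) (Fin N) K) a b) ≤ M)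
    {a₀ b₀ : Fin N} (hb₀ : b₀ ∈ S) (hab : Valued.v (((g : GL (Fin N) K) : Matrix (Fin N) (Fin N) K) a₀ b₀) = M) :
    (∃ s ∈ S, ∃ t ∈ S, (s.val < r ∨ r + m ≤ s.val) ∧ (t.val < r ∨ r + m ≤ t.val) ∧ Valued.v (((g : GL (Fin N) K) : Matrix (Fin N) (Fin N) K) s t) = M) ∨
    (∃ s ∈ S, ∃ t ∈ S, (s.val < r ∨ r + m ≤ s.val) ∧ (t.val < r ∨ r + m ≤ t.val) ∧
      Valued.v ((((g : GL (Fin N) K)⁻¹ : GL (Fin N) K) : Matrix (Fin N) (Fin N) K) s t) = M) := by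
  have hM0 : M ≠ 0 := ne_of_gt (lt_trans zero_lt_one hM1)
  -- entries of a column in `K^S` are bounded everywhere once bounded on `S`
  have hcol : ∀ {A : Matrix (Fin N) (Fin N) K} {b : Fin N}, A *ᵥ Pi.single b 1 ∈ frame K N S → (∀ a ∈ S, Valued.v (A a b) ≤ M) →
      ∀ a, Valued.v (A a b) ≤ M := fun {A b} hAS hAb a => by
    by_cases ha : a ∈ S
    · exact hAb a ha
    · rw [apply_eq_mulVec_single A a b, hAS a ha, map_zero]; exact zero_le
  by_cases hb : b₀.val < r ∨ r + m ≤ b₀.val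
  · obtain ⟨s, hsS, hs, hsM⟩ := exists_hyperbolic_row_of_hyperbolic_col σ e hstd Han hvσ hϖ hmax g hb (hgS b₀ hb₀) (hcol (hgS b₀ hb₀) fun a ha => hle a ha b₀ hb₀) hab hM0
    exact Or.inl ⟨s, hsS, b₀, hb₀, hs, hb, hsM⟩
  · have hb₁ : r ≤ b₀.val := by omega
    have hb₂ : b₀.val < r + m := by omega
    obtain ⟨s, hsS, hs, hsM⟩ := exists_hyperbolic_row_of_kernel_col σ e hstd Han hvσ hϖ hint hmax g (hgS b₀ hb₀) hM1 (hcol (hgS b₀ hb₀) fun a ha => hle a ha b₀ hb₀) hab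
    have hrs : Fin.rev s ∈ S := hS s hsS
    have hrsh : (Fin.rev s).val < r ∨ r + m ≤ (Fin.rev s).val := rev_hyperbolic e hs
    -- the row identity: `g_{s b₀} = Σ_p σ((g⁻¹)_{p, rev s}) W_{p b₀}`, only kernel `p` contribute
    have hrow := apply_eq_sum_inv_of_hyperbolic σ e hstd Han g hs b₀
    -- some kernel `p` has `|(g⁻¹)_{p, rev s}| = M`
    have hex : ∃ p : Fin N, r ≤ p.val ∧ p.val < r + m ∧ Valued.v ((((g : GL (Fin N) K)⁻¹ : GL (Fin N) K) : Matrix (Fin N) (Fin N) K) p (Fin.rev s)) = M := by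
      by_contra hne
      push Not at hne
      have hlt : Valued.v (∑ p', σ ((((g : GL (Fin N) K)⁻¹ : GL (Fin N) K) : Matrix (Fin N) (Fin N) K) p' (Fin.rev s)) * wittFormOn e Han p' b₀) < M := by
        refine Valuation.map_sum_lt _ hM0 fun p _ => ?_
        by_cases hp : p.val < r ∨ r + m ≤ p.val
        · rw [wittFormOn_hyperbolic_kernel e hstd Han hb₁ hb₂ hp, mul_zero, map_zero]; exact zero_lt_iff.2 hM0
        · have hp₁ : r ≤ p.val := by omega
          have hp₂ : p.val < r + m := by omega
          rw [map_mul, hvσ]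
          have hpS : p ∈ S := hSk p hp₁ hp₂
          have hle' := hlei p hpS (Fin.rev s) hrs
          calc Valued.v ((((g : GL (Fin N) K)⁻¹ : GL (Fin N) K) : Matrix (Fin N) (Fin N) K) p (Fin.rev s)) * Valued.v (wittFormOn e Han p b₀)
              ≤ Valued.v ((((g : GL (Fin N) K)⁻¹ : GL (Fin N) K) : Matrix (Fin N) (Fin N) K) p (Fin.rev s)) * 1 :=
                mul_le_mul' le_rfl (v_wittFormOn_apply_le_one e Han hint p b₀)
            _ < M := by rw [mul_one]; exact lt_of_le_of_ne hle' (hne p hp₁ hp₂)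
      rw [← hrow, hsM] at hlt
      exact lt_irrefl _ hlt
    obtain ⟨p, hp₁, hp₂, hpM⟩ := hex
    -- the hyperbolic column `rev s` of `g⁻¹` attains `M`: first lemma for `g⁻¹`
    have hginv : ((((g⁻¹ : unitaryGroupOfForm σ (wittFormOn e Han)) : GL (Fin N) K)) : Matrix (Fin N) (Fin N) K) =
        (((g : GL (Fin N) K)⁻¹ : GL (Fin N) K) : Matrix (Fin N) (Fin N) K) := by rw [Subgroup.coe_inv]
    obtain ⟨s', hs'S, hs', hs'M⟩ := exists_hyperbolic_row_of_hyperbolic_col σ e hstd Han hvσ hϖ hmax g⁻¹ hrsh (by rw [hginv]; exact hgiS _ hrs)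
      (M := M) (fun a => by rw [hginv]; exact hcol (hgiS _ hrs) (fun a ha => hlei a ha _ hrs) a) (a₀ := p) (by rw [hginv]; exact hpM) hM0
    rw [hginv] at hs'M
    exact Or.inr ⟨s', hs'S, Fin.rev s, hrs, hs', hrsh, hs'M⟩

end Pivot

end Summit.HodgeConjecture.HodgeConjecture.Cruxes.H413.K2E3WittCartanPivot

end
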